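import Summits.CriticalPhenomena.CardyFormulaZ2.Theorems.CardyComplexConeParafermionToSLESixFamiliesDiamondDefs
import Summits.CriticalPhenomena.CardyFormulaZ2.Theorems.CardyComplexConeParafermionToSLESixFamiliesCollinearTraceConstant
import Literature.Probability.RandomPlanarGeometry.ConformalRectangleProofs
import HarnessLib

/-!
# Line `potential-darboux-picard-diamond`, stub S4 (`stub_identifyPotential`): the Riemann map of a Jordan domain and the collinear-trace dichotomy

Helper file of the stub `stub_identifyPotential` of crux `ParafermionToSLESixFamilies` (stmt-CriticalPhenomena-11389).
Steps (iii)–(iv) of the identification transport disc statements (S2 `DarbouxPicardConvex`, `TraceWindingNonneg`, and the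
landed `stub_collinearTraceConstant`, p127371) to the diamond `D` through a Riemann map `R : 𝔻 → D` with homeomorphic
Carathéodory extension. This file packages the tree's Riemann mapping theorem (`exists_conformalEquiv_ball_holds`) and
Carathéodory's theorem (`JordanDomain.exists_continuousOn_extension_holds`, Pommerenke Thm. 2.6, PROVED in the tree) into
the form consumed there (`exists_riemannMap_extension`), and proves the collinear-trace dichotomy on an arbitrary Jordan
domain (`collinearTrace_const_of_jordan`, registered helper of the crux item): a function holomorphic on `D`, continuous on
`closure D`, whose boundary values all lie on one real line is constant on `D` — the step "if the limit hexagon `K` were a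
segment, the potential limit `G` would be constant" of the engine.
-/

noncomputable section

namespace Summit.CriticalPhenomena.CardyFormulaZ2.Cruxes.ParafermionToSLESixFamilies.PotentialDarbouxPicardDiamond

open scoped Topology
open Filter Set Metric Complex
open Literature.Probability.RandomPlanarGeometry
open Summit.CriticalPhenomena.CardyFormulaZ2.Cruxes.ParafermionToSLESixFamilies.PotentialDarbouxPicard
  (stub_collinearTraceConstant)

/-- **Riemann map with Carathéodory extension.** Every Jordan domain `D` is the image of the unit disc under a conformal
equivalence `R` which extends to a continuous map `Φ` of the closed disc, a bijection `closedBall 0 1 → closure D` taking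
the unit circle bijectively onto `frontier D` (Riemann mapping theorem + Pommerenke Thm. 2.6, both theorems of the tree). -/
theorem exists_riemannMap_extension (D : JordanDomain) :
    ∃ (R : ConformalEquiv (ball (0 : ℂ) 1) D.carrier) (Φ : ℂ → ℂ), ContinuousOn Φ (closedBall 0 1) ∧
      EqOn Φ R (ball 0 1) ∧ BijOn Φ (closedBall 0 1) (closure D.carrier) ∧
      BijOn Φ (sphere 0 1) (frontier D.carrier) := by
  have hsc : IsSimplyConnected D.carrier :=
    Complex.isSimplyConnected_of_isPreconnected_frontier D.isOpen D.isConnected D.isBounded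
      (D.range_boundary ▸ isPreconnected_range D.continuous_boundary)
  obtain ⟨ψ⟩ := (exists_conformalEquiv_ball_holds (U := D.carrier)) D.isOpen hsc D.carrier_ne_univ
  obtain ⟨Φ, hΦc, hΦeq, hbij, hsph⟩ := JordanDomain.exists_continuousOn_extension_holds D ψ.symm
  exact ⟨ψ.symm, Φ, hΦc, hΦeq, hbij, hsph⟩

/-- **Collinear boundary trace ⇒ constant, on a Jordan domain.** If `G` is holomorphic on a Jordan domain `D`, continuous
on `closure D`, and all its boundary values lie on the real line `{w | im (e^{−iα} w) = c}`, then `G` is constant on `D`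
(the disc case `stub_collinearTraceConstant` transported through a Riemann map with its Carathéodory extension). -/
theorem collinearTrace_const_of_jordan : ∀ (D : JordanDomain) (G : ℂ → ℂ) (α c : ℝ), DifferentiableOn ℂ G D.carrier → ContinuousOn G (closure D.carrier) → (∀ x ∈ frontier D.carrier, (Complex.exp (-((α : ℂ) * Complex.I)) * G x).im = c) → ∀ z ∈ D.carrier, ∀ w ∈ D.carrier, G z = G w := by
  intro D G α c hGd hGc hb z hz w hw
  obtain ⟨R, Φ, hΦc, hΦeq, hbij, hsph⟩ := exists_riemannMap_extension D
  -- the pulled-back function on the closed disc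
  set F : ℂ → ℂ := fun u => G (Φ u) with hF
  have hFd : DifferentiableOn ℂ F (ball 0 1) := by
    have h1 : DifferentiableOn ℂ (fun u => G (R u)) (ball 0 1) := hGd.comp R.differentiableOn R.mapsTo
    exact h1.congr fun u hu => by simp only [hF, hΦeq hu]
  have hFc : ContinuousOn F (closedBall 0 1) := hGc.comp hΦc hbij.mapsTo
  have hFb : ∀ t : ℝ, (exp (-((α : ℂ) * I)) * F (exp ((t : ℂ) * I))).im = c := by
    intro t
    have hmem : exp ((t : ℂ) * I) ∈ sphere (0 : ℂ) 1 := by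
      rw [mem_sphere_zero_iff_norm, norm_exp_ofReal_mul_I]
    exact hb _ (hsph.mapsTo hmem)
  have hconst := stub_collinearTraceConstant F α c hFd hFc hFb
  -- `z = R u`, `w = R v` with `u, v` in the disc
  obtain ⟨u, hu, rfl⟩ := R.bijOn.surjOn hz
  obtain ⟨v, hv, rfl⟩ := R.bijOn.surjOn hw
  have h1 : G (R u) = F u := by simp only [hF, hΦeq hu]
  have h2 : G (R v) = F v := by simp only [hF, hΦeq hv]
  rw [h1, h2, hconst u hu, hconst v hv]

end Summit.CriticalPhenomena.CardyFormulaZ2.Cruxes.ParafermionToSLESixFamilies.PotentialDarbouxPicardDiamond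

end
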